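import Summits.Langlands.Langlands.Theorems.PhantomRMYoshidaResiduallyYoshidaLiftingKlingenReduction
import Summits.Langlands.Langlands.Theorems.PhantomRMYoshidaResiduallyYoshidaLiftingSplit
import HarnessLib

/-!
# Route `PhantomRMYoshida`, crux `ResiduallyYoshidaLifting` (stmt-Langlands-13639), line `sector-klingen-split`,
# skeleton rev 6: the anchored propagation stub R1d-rel is implied by the CRUX

Lead prover-line-stmt-Langlands-13639-c3-0 (2026-08-17), rev 6.  Companion of `…Rev6OfCrux.lean`: the propagation stub of rev 6,
`stub_nonsplitPropagationRel` (= rev-5 R1d-K — Skinner–Wiles propagation on the Klingen-ordinary family of the non-split `ρ̄_B`,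
Klingen-shape automorphic realiser `ρ₁` of the same class — plus the crux's relative hypothesis `∃ ρ₀` automorphic irreducible
`Sh`-point on the fibre), is implied by the CRUX `ResiduallyYoshidaLifting`: the anchor feeds the crux, the `Sh`-point `ρ` is then
automorphic (oddness from `DetC`) and its own Klingen approximant (`isKlingenClassicalLimit_of_aut`, p116982).  With `…Rev6OfCrux.lean`
every DENSITY stub of rev 6 is ≤ the crux and the classicality stub KL2 is ≤ the route target: the skeleton exceeds the crux by exactly
KL2 (`RelSectorSplit.relSubs_iff`).  Registered sub-goal `stub_nonsplitPropagationRel_of_crux`; nothing is asserted.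
-/

noncomputable section

-- `Summit.Langlands.Langlands.…` (summit = sub-problem name, D-0017 layout) trips `dupNamespace` on every decl.
set_option linter.dupNamespace false
set_option autoImplicit false

open IsDedekindDomain Filter
open Literature.NumberTheory.GaloisRepresentations Literature.NumberTheory.Automorphic
open Summit.Langlands.Langlands.Cruxes.ResiduallyYoshidaLifting.YoshidaDivisorSelmerCount
open Summit.Langlands.Langlands.Cruxes.ResiduallyYoshidaLifting.SectorSplit

namespace Summit.Langlands.Langlands.Cruxes.ResiduallyYoshidaLifting.SectorKlingenSplit

/-- **R1d-rel ≤ crux** (registered sub-goal `stub_nonsplitPropagationRel_of_crux`): under the crux the irreducible `Sh`-point `ρ`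
of an anchored fibre is automorphic, hence its own Klingen approximant; the class `B`, its realisation and the Klingen-shape realiser
`ρ₁` are not consumed. -/
theorem stub_nonsplitPropagationRel_of_crux :
    Summit.Langlands.Langlands.Theses.PhantomRMYoshida.ResiduallyYoshidaLifting → (∀ (p : ℕ) [Fact p.Prime], p ≠ 2 → ∀
    (k : Type) [Field k] [CharP k p] [IsAlgClosed k] [TopologicalSpace k] [DiscreteTopology k] (red : Valued.integer
    (PadicAlgCl p) →+* k) (σ σ' : FramedGaloisRep ℚ k 2) (hcpt : isCompact_glFiniteIntegralLevel 4 ℚ) (ι : PadicAlgCl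
    p ≃+* ℂ) (ρ : FramedGaloisRep ℚ (PadicAlgCl p) 4) (B : Field.absoluteGaloisGroup ℚ → Matrix (Fin 2) (Fin 2) k),
    σ.toGaloisRep.IsIrreducible → σ'.toGaloisRep.IsIrreducible → DetC p k σ σ' → (¬ ∃ g : GL (Fin 2) k, ∀ x, g * σ x *
    g⁻¹ = σ' x) → GenericSector p k σ σ' → (∃ ρ₀ : FramedGaloisRep ℚ (PadicAlgCl p) 4, ρ₀.toGaloisRep.IsIrreducible ∧
    Sh p k red σ σ' ρ₀ ∧ Aut p hcpt ι ρ₀) → (¬ ∃ X : Matrix (Fin 2) (Fin 2) k, ∀ g, B g = (σ g).val * X - X * (σ'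
    g).val) → ρ.toGaloisRep.IsIrreducible → Sh p k red σ σ' ρ → (∃ (P : GL (Fin 4) (PadicAlgCl p)) (rint :
    Field.absoluteGaloisGroup ℚ →* GL (Fin 4) (Valued.integer (PadicAlgCl p))) (h : GL (Fin 4) k), (∀ g,
    Matrix.GeneralLinearGroup.map (Valued.integer (PadicAlgCl p)).subtype (rint g) = P⁻¹ * ρ g * P) ∧ (∀ g,
    (Matrix.GeneralLinearGroup.map red (rint g)).val = h.val * Matrix.reindex finSumFinEquiv finSumFinEquiv
    (Matrix.fromBlocks (σ g).val (B g) 0 (σ' g).val) * (h⁻¹).val)) → (∃ ρ₁ : FramedGaloisRep ℚ (PadicAlgCl p) 4,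
    ρ₁.toGaloisRep.IsIrreducible ∧ Aut p hcpt ι ρ₁ ∧ (∃ c : ℕ, (c : ZMod (p - 1)) = 1 ∧ (∃ ν :
    Field.absoluteGaloisGroup ℚ → PadicAlgCl p, ρ₁.IsSymplecticWithMultiplierFun ν) ∧ ∀ v : HeightOneSpectrum
    (NumberField.RingOfIntegers ℚ), ((p : ℕ) : NumberField.RingOfIntegers ℚ) ∈ v.asIdeal →
    ρ₁.IsGreenbergOrdinaryOfShapeAt v ![0, 0, c, c] ∧ ρ₁.IsResiduallyDistinguishedAt v ![0, 0, c, c]) ∧ ∃ (P : GL (Fin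
    4) (PadicAlgCl p)) (rint : Field.absoluteGaloisGroup ℚ →* GL (Fin 4) (Valued.integer (PadicAlgCl p))) (h : GL (Fin
    4) k), (∀ g, Matrix.GeneralLinearGroup.map (Valued.integer (PadicAlgCl p)).subtype (rint g) = P⁻¹ * ρ₁ g * P) ∧ (∀
    g, (Matrix.GeneralLinearGroup.map red (rint g)).val = h.val * Matrix.reindex finSumFinEquiv finSumFinEquiv
    (Matrix.fromBlocks (σ g).val (B g) 0 (σ' g).val) * (h⁻¹).val)) → IsKlingenClassicalLimit p hcpt ι ρ) := by
  intro hC p _ hp k _ _ _ _ _ red σ σ' hcpt ι ρ B hσ hσ' hdet hnc _hG hanch _hncB hρ hSh _hreal _hanchor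
  obtain ⟨ρ₀, hρ₀, hSh₀, hA₀⟩ := hanch
  exact isKlingenClassicalLimit_of_aut hSh
    (hC p hp k red σ σ' hcpt ι ρ₀ ρ (isOdd_of_detC hdet).1 (isOdd_of_detC hdet).2 hσ hσ' hdet hnc hρ₀ hSh₀ hA₀ hρ hSh)

end Summit.Langlands.Langlands.Cruxes.ResiduallyYoshidaLifting.SectorKlingenSplit

end
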